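import Mathlib
import Literature.Computability.Complexity.CliqueThresholdBounds
import HarnessLib

/-!
# Route NegLimited — door support `PlantedQuartCliqueNullMass` (line `correlation-door`, stub 3; rung F-N1/p3, ROUND-8 §B)

Registered stub `stub_plantedQuartCliqueNullMass` of the skeleton `correlation-door` on the door item
`NegLimited.NeglimitedEpsLogNegationsR` (stmt-PneNP-19860; HOME/pnp-ideate-p3/r9/Skeleton-R9-door.lean;
statement = turnkey-R8/add_items_door_v2.json item `PlantedQuartCliqueNullMass`, verbatim): under
`G(m, 1/2)` the event "no `⌊m^{1/4}⌋`-clique" (`cliqueFn m ⌊√⌊√m⌋⌋ = 0`) has probability `≥ 1/2`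
eventually.

Proof (first moment through the tree's Harris bound `exp_le_gnpProb_cliqueFree`:
`Pr[ω_k = 0] ≥ exp(-2 C(m,k) 2^{-C(k,2)})`): with `k = ⌊√⌊√m⌋⌋` one has `m < (k+1)^4`, hence
`4m² < 4(k+1)^8 ≤ 2^{k-1}` once `k ≥ 96`, so `(2m)^k ≤ 2^{C(k,2)}` and
`C(m,k)·2^{-C(k,2)} ≤ m^k/(2m)^k = 2^{-k} ≤ 1/4 ≤ (log 2)/2`, giving `Pr[ω_k = 0] ≥ e^{-log 2} = 1/2`;
finally `{ω_k = 0} = {cliqueFn = 0}` (`cliqueCount_eq_zero_iff`).  Elementary integer arithmetic only;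
"eventually" = `m ≥ 9216²` (so that `k ≥ 96`).
-/

set_option linter.dupNamespace false -- `Summit.PneNP.PneNP.…`: summit = sub-problem name (D-0017 single-conjunct layout)

namespace Summit.PneNP.PneNP.Theorems.NegLimitedDoor

open Finset Filter
open Literature.Computability.Complexity

/-- The item statement `PlantedQuartCliqueNullMass` (verbatim: turnkey-R8/add_items_door_v2.json and the
registered skeleton `correlation-door`): eventually in `m`, `G(m, 1/2)` has NO `⌊m^{1/4}⌋`-clique with
probability at least `1/2`. -/
def PlantedQuartCliqueNullMass : Prop :=
  ∀ᶠ m : ℕ in Filter.atTop, (1 / 2 : ℝ) ≤ Literature.Computability.Complexity.gnpProb m (1 / 2) (Finset.univ.filter fun x => Literature.Computability.Complexity.cliqueFn m (Nat.sqrt (Nat.sqrt m)) x = false)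

/-! ### Integer arithmetic around `k = ⌊√⌊√m⌋⌋` -/

/-- `4 (k+1)^8 ≤ 2^{k-1}` for `k ≥ 96` (crude: `k + 1 ≤ 16 (k/16 + 1) < 2^{k/16 + 5}`). -/
theorem four_mul_succ_pow_eight_le {k : ℕ} (hk : 96 ≤ k) : 4 * (k + 1) ^ 8 ≤ 2 ^ (k - 1) := by
  set j := k / 16 with hj
  have hj16 : 16 * j ≤ k := Nat.mul_div_le k 16
  have hkj : k + 1 ≤ 16 * (j + 1) := by omega
  have hj1 : j + 1 < 2 ^ (j + 1) := Nat.lt_two_pow_self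
  have hk1 : k + 1 ≤ 2 ^ (j + 5) := by
    calc k + 1 ≤ 16 * (j + 1) := hkj
      _ ≤ 16 * 2 ^ (j + 1) := Nat.mul_le_mul_left 16 hj1.le
      _ = 2 ^ (j + 5) := by rw [show j + 5 = (j + 1) + 4 by omega, pow_add]; norm_num; ring
  have h8 : (k + 1) ^ 8 ≤ 2 ^ (8 * (j + 5)) := by
    calc (k + 1) ^ 8 ≤ (2 ^ (j + 5)) ^ 8 := Nat.pow_le_pow_left hk1 8
      _ = 2 ^ (8 * (j + 5)) := by rw [← pow_mul, mul_comm]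
  have hexp : 8 * (j + 5) + 2 ≤ k - 1 := by omega
  calc 4 * (k + 1) ^ 8 ≤ 4 * 2 ^ (8 * (j + 5)) := Nat.mul_le_mul_left 4 h8
    _ = 2 ^ (8 * (j + 5) + 2) := by rw [pow_add]; ring
    _ ≤ 2 ^ (k - 1) := Nat.pow_le_pow_right (by norm_num) hexp

/-- `2 C(k,2) = (k-1) k`. -/
theorem two_mul_choose_two (k : ℕ) : 2 * k.choose 2 = (k - 1) * k := by
  rw [Nat.choose_two_right, Nat.two_mul_div_two_of_even (Nat.even_mul_pred_self k), mul_comm]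

/-- The key count: for `k = ⌊√⌊√m⌋⌋ ≥ 96`, `(2m)^k ≤ 2^{C(k,2)}`. -/
theorem two_mul_pow_le_two_pow_choose {m : ℕ} (hk : 96 ≤ Nat.sqrt (Nat.sqrt m)) :
    (2 * m) ^ Nat.sqrt (Nat.sqrt m) ≤ 2 ^ (Nat.sqrt (Nat.sqrt m)).choose 2 := by
  set k := Nat.sqrt (Nat.sqrt m) with hkdef
  -- `4 m² ≤ 2^{k-1}`
  have hm4 : m < (k + 1) ^ 4 := by
    -- `m < (⌊√m⌋+1)² ≤ ((k+1)²)²` (the same three lines as the tree's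
    -- `Literature.NumberTheory.LFunctions.SiegelWalfiszLiouville.lt_sqrt_sqrt_add_one_pow`, inlined to
    -- avoid importing L-function material into a circuit file)
    have h1 : m < (Nat.sqrt m + 1) * (Nat.sqrt m + 1) := Nat.lt_succ_sqrt m
    have h3 : Nat.sqrt m + 1 ≤ (k + 1) * (k + 1) := Nat.lt_succ_sqrt (Nat.sqrt m)
    calc m < (Nat.sqrt m + 1) * (Nat.sqrt m + 1) := h1
      _ ≤ ((k + 1) * (k + 1)) * ((k + 1) * (k + 1)) := Nat.mul_le_mul h3 h3
      _ = (k + 1) ^ 4 := by ring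
  have hm8 : m ^ 2 < (k + 1) ^ 8 := by
    have := Nat.pow_lt_pow_left hm4 (two_ne_zero)
    rwa [← pow_mul] at this
  have hm2 : 4 * m ^ 2 ≤ 2 ^ (k - 1) :=
    le_trans (Nat.mul_le_mul_left 4 hm8.le) (four_mul_succ_pow_eight_le hk)
  -- square both sides
  have hsq : ((2 * m) ^ k) ^ 2 ≤ (2 ^ k.choose 2) ^ 2 := by
    have e1 : ((2 * m) ^ k) ^ 2 = (4 * m ^ 2) ^ k := by
      rw [← pow_mul, mul_comm k 2, pow_mul]
      congr 1
      ring
    have e2 : (2 ^ k.choose 2) ^ 2 = (2 ^ (k - 1)) ^ k := by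
      rw [← pow_mul, ← pow_mul, mul_comm (k.choose 2) 2, two_mul_choose_two k]
    rw [e1, e2]
    exact Nat.pow_le_pow_left hm2 k
  exact (pow_le_pow_iff_left₀ (Nat.zero_le _) (Nat.zero_le _) two_ne_zero).1 hsq

/-! ### The stub -/

/-- **Stub 3 of line `correlation-door` PROVED** (`PlantedQuartCliqueNullMass`, by name): eventually in
`m`, `Pr_{G(m,1/2)}[no ⌊m^{1/4}⌋-clique] ≥ 1/2` — first moment `C(m,k) 2^{-C(k,2)} ≤ 2^{-k} ≤ 1/4`
fed into the tree's Harris bound `exp_le_gnpProb_cliqueFree`. -/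
theorem stub_plantedQuartCliqueNullMass : PlantedQuartCliqueNullMass := by
  -- eventually `k = ⌊√⌊√m⌋⌋ ≥ 96`
  have hev : ∀ᶠ m : ℕ in atTop, 96 ≤ Nat.sqrt (Nat.sqrt m) := by
    filter_upwards [eventually_ge_atTop (9216 * 9216)] with m hm
    rw [Nat.le_sqrt, Nat.le_sqrt]
    omega
  filter_upwards [hev] with m hk
  set k := Nat.sqrt (Nat.sqrt m) with hkdef
  have hk2 : 2 ≤ k := by omega
  have hm1 : 1 ≤ m := by
    by_contra h
    have hm0 : m = 0 := by omega
    have : k = 0 := by rw [hkdef, hm0]; rfl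
    omega
  -- the first moment is `≤ 1/4`
  have h2m : ((2 : ℝ) * m) ^ k ≤ (2 : ℝ) ^ k.choose 2 := by
    exact_mod_cast two_mul_pow_le_two_pow_choose hk
  have hX : (m.choose k : ℝ) * (1 / 2 : ℝ) ^ k.choose 2 ≤ 1 / 4 := by
    have hC : (m.choose k : ℝ) ≤ (m : ℝ) ^ k := by
      have h := Nat.choose_le_pow_div (α := ℝ) k m
      refine h.trans (div_le_self (by positivity) ?_)
      exact_mod_cast Nat.one_le_iff_ne_zero.2 (Nat.factorial_ne_zero k)
    have hm0 : (0 : ℝ) < m := by exact_mod_cast hm1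
    calc (m.choose k : ℝ) * (1 / 2 : ℝ) ^ k.choose 2
        ≤ (m : ℝ) ^ k * (1 / 2 : ℝ) ^ k.choose 2 :=
          mul_le_mul_of_nonneg_right hC (by positivity)
      _ = (m : ℝ) ^ k / (2 : ℝ) ^ k.choose 2 := by rw [one_div, inv_pow, div_eq_mul_inv]
      _ ≤ (m : ℝ) ^ k / ((2 : ℝ) * m) ^ k :=
          div_le_div_of_nonneg_left (by positivity) (by positivity) h2m
      _ = ((m : ℝ) / ((2 : ℝ) * m)) ^ k := (div_pow _ _ _).symm
      _ = (1 / 2 : ℝ) ^ k := by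
          have hmm : (m : ℝ) / ((2 : ℝ) * m) = 1 / 2 := by field_simp
          rw [hmm]
      _ ≤ (1 / 2 : ℝ) ^ 2 := pow_le_pow_of_le_one (by norm_num) (by norm_num) hk2
      _ = 1 / 4 := by norm_num
  -- Harris: `Pr[ω_k = 0] ≥ exp(-2 X) ≥ exp(-log 2) = 1/2`
  have hpk : (1 / 2 : ℝ) ^ k.choose 2 ≤ 1 / 2 := by
    have h1 : 1 ≤ k.choose 2 := Nat.choose_pos hk2
    calc (1 / 2 : ℝ) ^ k.choose 2 ≤ (1 / 2 : ℝ) ^ 1 := pow_le_pow_of_le_one (by norm_num) (by norm_num) h1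
      _ = 1 / 2 := pow_one _
  have hH := exp_le_gnpProb_cliqueFree (n := m) (p := 1 / 2) (by norm_num) (by norm_num) k hpk
  have hexp : (1 / 2 : ℝ) ≤ Real.exp (-(2 * ((m.choose k : ℝ) * (1 / 2 : ℝ) ^ k.choose 2))) := by
    have h12 : (1 / 2 : ℝ) = Real.exp (-Real.log 2) := by
      rw [Real.exp_neg, Real.exp_log two_pos, one_div]
    have hlog := Real.log_two_gt_d9
    calc (1 / 2 : ℝ) = Real.exp (-Real.log 2) := h12
      _ ≤ Real.exp (-(2 * ((m.choose k : ℝ) * (1 / 2 : ℝ) ^ k.choose 2))) :=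
          Real.exp_le_exp.2 (by linarith)
  have hset : (univ.filter fun x => cliqueFn m k x = false) =
      (univ.filter fun x => cliqueCount m k x = 0) := by
    ext x
    simp only [mem_filter, mem_univ, true_and, cliqueCount_eq_zero_iff]
  rw [hset]
  exact hexp.trans hH

end Summit.PneNP.PneNP.Theorems.NegLimitedDoor
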